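import Mathlib.RingTheory.Kaehler.Basic
import Mathlib.FieldTheory.IntermediateField.Basic
import HarnessLib

/-!
# Mizutani's conjecture `m(e) = 2p^e − 1` — finite witnesses: `J^m` is realised on finitely generated subfields

Cell topic `Summits/ResolutionOfSingularities/KangarooAtlas` (pub-rosobs); namespace
`Summit.ResolutionOfSingularities.KangarooAtlas.Mizutani`.  Part of the Lean transcription of the
in-house note MIZUTANI-PROOF-g59 (AI-written, AI-audited; *AI review is weaker than expert review*; not a
resolution theorem).  §3 DICTIONARY, step (E) (the note's §3 (c): "`H_i` finite-dimensional lies in some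
`k' = 𝕜(x^{1/q'})` for finitely many members `x` of a `p`-basis … by flat base change"): an element of
`J^m ⊂ k ⊗_K k` (`J` the kernel of multiplication) only involves finitely many elements of `k`, so it comes
from `J_F^m ⊂ F ⊗_K F` for every intermediate field `F` containing a suitable finite set
(`exists_finset_realised_pow`).  This is what lets THEOREM F — a statement about FINITE towers
`K(x^{1/q})` — be applied to a tensor living over an arbitrary (possibly infinitely `p`-dimensional) field.

References: [Mizutani1973HironakaGroupSchemes] Remark 2.10 (in-house proof §3 (c));
[Oda1983HironakaGroupSchemeII] §1 (p. 1164–1166).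
-/

open TensorProduct

namespace Summit.ResolutionOfSingularities.KangarooAtlas.Mizutani

section Witness

variable (K : Type*) {k : Type*} [Field K] [Field k] [Algebra K k]

/-- The inclusion `F ⊗_K F → k ⊗_K k` of tensor squares. [folklore] -/
noncomputable abbrev tensorIncl (F : IntermediateField K k) : F ⊗[K] F →ₐ[K] k ⊗[K] k :=
  Algebra.TensorProduct.map F.val F.val

/-- Multiplication commutes with the inclusion of tensor squares. [folklore] -/
theorem val_lmul'_eq (F : IntermediateField K k) (z : F ⊗[K] F) :
    F.val (Algebra.TensorProduct.lmul' (S := F) K z) = Algebra.TensorProduct.lmul' (S := k) K (tensorIncl K F z) := by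
  induction z using TensorProduct.induction_on with
  | zero => simp only [map_zero]
  | tmul a b =>
    rw [Algebra.TensorProduct.lmul'_apply_tmul, Algebra.TensorProduct.map_tmul,
      Algebra.TensorProduct.lmul'_apply_tmul, map_mul]
  | add x y hx hy => rw [map_add, map_add, map_add, map_add, hx, hy]

/-- An element of `F ⊗ F` mapping into `J` lies in `J_F`. [folklore] -/
theorem mem_ideal_of_map_mem (F : IntermediateField K k) {z : F ⊗[K] F}
    (hz : tensorIncl K F z ∈ KaehlerDifferential.ideal K k) : z ∈ KaehlerDifferential.ideal K F := by
  rw [KaehlerDifferential.ideal, RingHom.mem_ker] at hz ⊢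
  apply F.val.toRingHom.injective
  rw [AlgHom.toRingHom_eq_coe, RingHom.coe_coe, val_lmul'_eq, map_zero]
  exact hz

/-- The set of `ω ∈ k ⊗_K k` REALISED at level `m` beyond the finite set `Y`: for every intermediate field
`F ⊇ Y`, `ω` is the image of an element of `J_F^m`. [cite: Mizutani1973HironakaGroupSchemes, Remark 2.10 (in-house proof §3 (c))] -/
def realisedSet (Y : Finset k) (m : ℕ) : Set (k ⊗[K] k) :=
  {ω | ∀ F : IntermediateField K k, (↑Y : Set k) ⊆ (F : Set k) →
    ∃ ω₂ : F ⊗[K] F, ω₂ ∈ KaehlerDifferential.ideal K F ^ m ∧ tensorIncl K F ω₂ = ω}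

/-- `Realised K Y m ω`: membership in `realisedSet`. [folklore] -/
abbrev Realised (Y : Finset k) (m : ℕ) (ω : k ⊗[K] k) : Prop := ω ∈ realisedSet K Y m

/-- Unfolding `Realised`. [folklore] -/
theorem realised_iff {Y : Finset k} {m : ℕ} {ω : k ⊗[K] k} :
    Realised K Y m ω ↔ ∀ F : IntermediateField K k, (↑Y : Set k) ⊆ (F : Set k) →
      ∃ ω₂ : F ⊗[K] F, ω₂ ∈ KaehlerDifferential.ideal K F ^ m ∧ tensorIncl K F ω₂ = ω :=
  Iff.rfl

variable {K}

/-- Enlarging the finite set preserves realisation. [folklore] -/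
theorem Realised.mono {Y Y' : Finset k} (h : Y ⊆ Y') {m : ℕ} {ω : k ⊗[K] k} (hω : Realised K Y m ω) :
    Realised K Y' m ω :=
  fun F hF => hω F (Set.Subset.trans (Finset.coe_subset.mpr h) hF)

/-- `0` is realised. [folklore] -/
theorem realised_zero (m : ℕ) : Realised K (∅ : Finset k) m (0 : k ⊗[K] k) :=
  fun _ _ => ⟨0, Submodule.zero_mem _, map_zero _⟩

/-- Sums of realised elements are realised (beyond the union). [folklore] -/
theorem Realised.add [DecidableEq k] {Y Y' : Finset k} {m : ℕ} {ω ω' : k ⊗[K] k}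
    (hω : Realised K Y m ω) (hω' : Realised K Y' m ω') : Realised K (Y ∪ Y') m (ω + ω') := by
  intro F hF
  rw [Finset.coe_union, Set.union_subset_iff] at hF
  obtain ⟨a, ha, rfl⟩ := hω F hF.1
  obtain ⟨b, hb, rfl⟩ := hω' F hF.2
  exact ⟨a + b, Ideal.add_mem _ ha hb, map_add _ a b⟩

/-- Every element of `k ⊗_K k` is realised at level `0` (it involves finitely many elements of `k`). [folklore] -/
theorem exists_realised_zero [DecidableEq k] (ω : k ⊗[K] k) : ∃ Y : Finset k, Realised K Y 0 ω := by
  induction ω using TensorProduct.induction_on with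
  | zero => exact ⟨∅, realised_zero 0⟩
  | tmul a b =>
    refine ⟨{a, b}, fun F hF => ?_⟩
    have ha : a ∈ F := hF (by simp)
    have hb : b ∈ F := hF (by simp)
    refine ⟨(⟨a, ha⟩ : F) ⊗ₜ[K] (⟨b, hb⟩ : F), by rw [pow_zero, Ideal.one_eq_top]; exact Submodule.mem_top, ?_⟩
    rw [Algebra.TensorProduct.map_tmul]
    rfl
  | add x y hx hy =>
    obtain ⟨Y, hY⟩ := hx
    obtain ⟨Y', hY'⟩ := hy
    exact ⟨Y ∪ Y', hY.add hY'⟩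

/-- The product of an element of `J` with a realised element of `J^m` is realised in `J^{m+1}`. [folklore] -/
theorem Realised.mul_mem [DecidableEq k] {Y Y' : Finset k} {m : ℕ} {j ω : k ⊗[K] k}
    (hj : j ∈ KaehlerDifferential.ideal K k) (hjY : Realised K Y 0 j) (hω : Realised K Y' m ω) :
    Realised K (Y ∪ Y') (m + 1) (j * ω) := by
  intro F hF
  rw [Finset.coe_union, Set.union_subset_iff] at hF
  obtain ⟨j₂, -, rfl⟩ := hjY F hF.1
  obtain ⟨ω₂, hω₂, rfl⟩ := hω F hF.2
  refine ⟨j₂ * ω₂, ?_, map_mul _ j₂ ω₂⟩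
  rw [pow_succ']
  exact Ideal.mul_mem_mul (mem_ideal_of_map_mem K F hj) hω₂

/-- **Finite witnesses for `J^m`**: every `ω ∈ J^m ⊂ k ⊗_K k` is realised at level `m` beyond some finite
set `Y ⊂ k` — for every intermediate field `F ⊇ Y`, `ω` is the image of an element of `J_F^m ⊂ F ⊗_K F`.
[cite: Mizutani1973HironakaGroupSchemes, Remark 2.10 (in-house proof §3 (c): reduction to a finitely generated tower)] -/
theorem exists_finset_realised_pow [DecidableEq k] :
    ∀ (m : ℕ) {ω : k ⊗[K] k}, ω ∈ KaehlerDifferential.ideal K k ^ m → ∃ Y : Finset k, Realised K Y m ω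
  | 0, ω, _ => exists_realised_zero ω
  | m + 1, ω, hω => by
    rw [pow_succ'] at hω
    refine Submodule.mul_induction_on hω (fun j hj w hw => ?_) (fun x y hx hy => ?_)
    · obtain ⟨Y, hY⟩ := exists_realised_zero j
      obtain ⟨Y', hY'⟩ := exists_finset_realised_pow m hw
      exact ⟨Y ∪ Y', Realised.mul_mem hj hY hY'⟩
    · obtain ⟨Y, hY⟩ := hx
      obtain ⟨Y', hY'⟩ := hy
      exact ⟨Y ∪ Y', hY.add hY'⟩

/-- The inclusion of tensor squares maps generators `1 ⊗ y^p − y^p ⊗ 1` to generators, hence (Frobenius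
powers of) diagonal ideals into the corresponding ideals: if `ω₂ ∈ I₂` maps to `ω` and `I₂` maps into `I`,
then `ω ∉ I` forces `ω₂ ∉ I₂` — used for `I_S`. Recorded as the trivial contrapositive. [folklore] -/
theorem not_mem_of_map_not_mem {F : IntermediateField K k} {I₂ : Ideal (F ⊗[K] F)} {I : Ideal (k ⊗[K] k)}
    (hle : I₂.map (tensorIncl K F) ≤ I) {ω₂ : F ⊗[K] F} (hω : tensorIncl K F ω₂ ∉ I) : ω₂ ∉ I₂ :=
  fun h => hω (hle (Ideal.mem_map_of_mem _ h))

end Witness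

end Summit.ResolutionOfSingularities.KangarooAtlas.Mizutani
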